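import Summits.CriticalPhenomena.Ising3DConformalLimit.Theorems.LeeYangGapNearCriticalLeeYangGapCriticalWindowVarianceReductions
import Summits.CriticalPhenomena.Ising3DConformalLimit.Theorems.LeeYangGapNearCriticalLeeYangGapCorrLengthUnbounded
import Summits.CriticalPhenomena.Ising3DConformalLimit.Theorems.PrecisionLaplacianTwoPointSpineGlueLogConvex
import Summits.CriticalPhenomena.Ising3DConformalLimit.Theorems.MirrorHoelderCompactnessSeparableHoelderLattice

/-!
# Stub S2d `stub_susceptibilityComparability_of_oneScale`: one window constant suffices (MMS doubling)

Route `LeeYangGap` (Ising3DConformalLimit), crux `NearCriticalLeeYangGap` (item stmt-CriticalPhenomena-4945),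
line `registered`, skeleton v5. This file LANDS the registered glue stub S2d
`stub_susceptibilityComparability_of_oneScale` (exact registered signature, last declaration of the
file) together with the Messager–Miracle-Solé doubling lemmas for the critical box susceptibility it
rests on. With S2d landed, the open core of S2 is the single-scale stub S2χ₁
`stub_susceptibilityComparabilityOneScale`,

  `∃ r A β₂, 0 < r ∧ 0 < A ∧ β₂ < β_c ∧ ∀ β ∈ [β₂, β_c) ∀ n ≤ r ξ(β), χ_n(β_c) ≤ A χ(β)`,

which is NOT proved, assumed or restated here (it is the antecedent of S2d, open on `ℤ³`: the
amplitude form of the Fisher half `γ ≥ (2-η)ν` at one scale); S2d upgrades it to every window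
constant:

  `∀ R > 0 ∃ A > 0 ∃ β₂ < β_c ∀ β ∈ [β₂, β_c) ∀ n ≤ R ξ(β), χ_n(β_c) ≤ A χ(β)`.

Notation (`d = 3`, nearest-neighbour Ising): `Λ_n = box 3 n` (`|Λ_n| = (2n+1)³`),
`G_c(x) = criticalTwoPoint 3 x = twoPointPlus 3 β_c x = ⟨σ₀σ_x⟩⁺_{β_c}`,
`χ_n(β_c) = Σ_{z ∈ Λ_n} G_c(z)` the critical box susceptibility, `χ(β) = susceptibility 3 β` the
(free) susceptibility (in `ℝ≥0∞`, read through `.toReal`), `ξ(β) = isingCorrLength 3 β` (plus-state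
axis correlation length), `e₁ = Pi.single 0 1`.

What is proved here (everything sorry-free):

* `criticalTwoPoint_axis_le` — the lower half `G_c(s e₁) ≤ G_c(x)` for `3‖x‖_∞ ≤ s` of the
  Messager–Miracle-Solé sandwich at `β_c` (the upper half `G_c(x) ≤ G_c(s e₁)` for `s ≤ ‖x‖_∞` and
  plus = free at `β_c` are the landed `MirrorHoelderCompactnessSeparableHoelder.criticalTwoPoint_le_single_of_le`
  and `Theorems.SpineGlue.criticalTwoPoint_eq_free`, reused);
* `criticalBoxSum_two_mul_le` — **doubling of the critical box susceptibility**: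
  `χ_{2n}(β_c) ≤ 217 χ_n(β_c)` for every `n` (the shell `Λ_{2n} ∖ Λ_n` carries at most
  `|Λ_{2n}| G_c((n+1)e₁)`, while `χ_n(β_c) ≥ |Λ_m| G_c((n+1)e₁)` for `m = ⌊(n+1)/3⌋`, and
  `|Λ_{2n}| ≤ 216 |Λ_m|`); iterated: `criticalBoxSum_two_pow_mul_le`
  (`χ_{2^k n}(β_c) ≤ 217^k χ_n(β_c)`);
* `eventually_le_isingCorrLength` — `ξ(β) → ∞` uniformly on `[β₀, β_c)` (landed S1u
  `stub_corrLengthUnbounded` + monotonicity of `ξ` on `(0, β_c)`);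
* `susceptibilityComparability_of_oneScale` — comparability at ONE window constant `r > 0` implies it
  at every `R > 0` (with `A' = 217^k A`, `2^k ≥ 2R/r`, on `[β₀, β_c) ⊆ [β₂, β_c)` where `r ξ ≥ 2`:
  for `n ≤ R ξ(β)` and `n₀ = ⌊r ξ(β)⌋ ≥ r ξ(β)/2`, `n ≤ 2^k n₀`, so
  `χ_n(β_c) ≤ χ_{2^k n₀}(β_c) ≤ 217^k χ_{n₀}(β_c) ≤ 217^k A χ(β)`);
  `susceptibilityComparability_iff_oneScale` — the all-`R` form is equivalent to the one-scale form;
* **`stub_susceptibilityComparability_of_oneScale`** — the registered stub S2d verbatim.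

## References

* A. Messager, S. Miracle-Solé, J. Stat. Phys. 17 (1977) [MessagerMiracleSole1977]; G. C. Hegerfeldt,
  Comm. Math. Phys. 57 (1977) [Hegerfeldt1977] (monotonicity of Ising correlations).
* M. Aizenman, H. Duminil-Copin, V. Sidoravicius, Comm. Math. Phys. 334 (2015), §3.3
  (`⟨σ₀σ_x⟩⁺_{β_c} = ⟨σ₀σ_x⟩^∅_{β_c}` on `ℤ³`) [AizenmanDuminilCopinSidoravicius2015].
* S. Friedli, Y. Velenik, Statistical Mechanics of Lattice Systems (CUP 2017), §3.7.4 [FriedliVelenik2017].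
-/

noncomputable section

namespace Summit.CriticalPhenomena.Ising3DConformalLimit.LeeYangGapNearCriticalLeeYangGap

open Literature.Probability.LatticeModels Filter Set Finset
open scoped Topology BigOperators ENNReal
open Summit.CriticalPhenomena.Ising3DConformalLimit.LeeYangGapGaussianLimitKillsBlockCoupling
  (boxSum_mono boxSum_nonneg)
open Summit.CriticalPhenomena.Ising3DConformalLimit.Theorems.SpineGlue (criticalTwoPoint_eq_free)
open Summit.CriticalPhenomena.Ising3DConformalLimit.MirrorHoelderCompactnessSeparableHoelder
  (criticalTwoPoint_le_single_of_le)

/-! ### Messager–Miracle-Solé at `β_c` -/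

/- Plus = free at `β_c` on `ℤ³` (Aizenman–Duminil-Copin–Sidoravicius 2015) is the landed
`Theorems.SpineGlue.criticalTwoPoint_eq_free`; the upper MMS half `G_c(x) ≤ G_c(s e₁)` for
`s ≤ ‖x‖_∞` is the landed `MirrorHoelderCompactnessSeparableHoelder.criticalTwoPoint_le_single_of_le`
(both opened above). -/

/-- **MMS, diagonal-axis form at `β_c`**: `G_c(s e₁) ≤ G_c(x)` whenever `3 ‖x‖_∞ ≤ s`. -/
theorem criticalTwoPoint_axis_le {x : Site 3} {s : ℕ} (hs : 3 * Site.supNorm x ≤ s) :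
    criticalTwoPoint 3 (Pi.single 0 (s : ℤ)) ≤ criticalTwoPoint 3 x := by
  have hβ : (0 : ℝ) ≤ criticalBeta 3 := criticalBeta_nonneg 3
  have h3 : (1 : ℕ) ≤ 3 := by norm_num
  rw [criticalTwoPoint_eq_free, criticalTwoPoint_eq_free]
  refine le_trans ?_ (twoPointFree_diagAxis_le_of_mem_sphere' hβ h3 (self_mem_sphere x))
  obtain ⟨t, ht⟩ : ∃ t, s = 3 * Site.supNorm x + t := ⟨s - 3 * Site.supNorm x, by omega⟩
  have h := twoPointFree_add_single_le hβ
    (Pi.single (⟨0, h3⟩ : Fin 3) (((3 : ℕ) : ℤ) * ((Site.supNorm x : ℕ) : ℤ))) ⟨0, h3⟩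
    (by simp) t
  rw [← Pi.single_add] at h
  rw [ht]
  push_cast at h ⊢
  exact h

/-! ### Doubling of the critical box susceptibility -/

/-- `|Λ_m| G_c(s e₁) ≤ χ_n(β_c)` whenever `3m ≤ s` and `m ≤ n`. -/
theorem card_mul_axis_le_criticalBoxSum {m s n : ℕ} (hms : 3 * m ≤ s) (hmn : m ≤ n) :
    (((2 * m + 1) ^ 3 : ℕ) : ℝ) * criticalTwoPoint 3 (Pi.single 0 (s : ℤ)) ≤
      ∑ z ∈ box 3 n, criticalTwoPoint 3 z := by
  calc (((2 * m + 1) ^ 3 : ℕ) : ℝ) * criticalTwoPoint 3 (Pi.single 0 (s : ℤ))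
      = ∑ _z ∈ box 3 m, criticalTwoPoint 3 (Pi.single 0 (s : ℤ)) := by
        rw [Finset.sum_const, card_box, nsmul_eq_mul]
    _ ≤ ∑ z ∈ box 3 m, criticalTwoPoint 3 z := by
        refine Finset.sum_le_sum fun z hz => criticalTwoPoint_axis_le ?_
        have := mem_box_iff_supNorm_le.1 hz
        omega
    _ ≤ ∑ z ∈ box 3 n, criticalTwoPoint 3 z := boxSum_mono hmn

/-- `χ_N(β_c) ≤ χ_n(β_c) + |Λ_N| G_c((n+1) e₁)` for `n ≤ N` (the shell `Λ_N ∖ Λ_n` lies at sup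
distance `≥ n + 1`). -/
theorem criticalBoxSum_le_add_card_mul_axis {n N : ℕ} (hnN : n ≤ N) :
    ∑ z ∈ box 3 N, criticalTwoPoint 3 z ≤
      ∑ z ∈ box 3 n, criticalTwoPoint 3 z +
        (((2 * N + 1) ^ 3 : ℕ) : ℝ) * criticalTwoPoint 3 (Pi.single 0 ((n + 1 : ℕ) : ℤ)) := by
  have hsplit : ∑ z ∈ box 3 N, criticalTwoPoint 3 z =
      ∑ z ∈ box 3 n, criticalTwoPoint 3 z + ∑ z ∈ box 3 N \ box 3 n, criticalTwoPoint 3 z := by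
    rw [← Finset.sum_sdiff (box_mono 3 hnN), add_comm]
  rw [hsplit]
  gcongr
  calc ∑ z ∈ box 3 N \ box 3 n, criticalTwoPoint 3 z
      ≤ ∑ _z ∈ box 3 N \ box 3 n, criticalTwoPoint 3 (Pi.single 0 ((n + 1 : ℕ) : ℤ)) := by
        refine Finset.sum_le_sum fun z hz => criticalTwoPoint_le_single_of_le ?_
        rw [Finset.mem_sdiff, mem_box_iff_supNorm_le, mem_box_iff_supNorm_le] at hz
        omega
    _ = (#(box 3 N \ box 3 n) : ℝ) * criticalTwoPoint 3 (Pi.single 0 ((n + 1 : ℕ) : ℤ)) := by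
        rw [Finset.sum_const, nsmul_eq_mul]
    _ ≤ (((2 * N + 1) ^ 3 : ℕ) : ℝ) * criticalTwoPoint 3 (Pi.single 0 ((n + 1 : ℕ) : ℤ)) := by
        refine mul_le_mul_of_nonneg_right ?_ (criticalTwoPoint_nonneg' _)
        rw [← card_box 3 N]
        exact_mod_cast Finset.card_le_card Finset.sdiff_subset

/-- **Doubling of the critical box susceptibility** (Messager–Miracle-Solé only):
`χ_{2n}(β_c) ≤ 217 χ_n(β_c)` for every `n`. -/
theorem criticalBoxSum_two_mul_le (n : ℕ) :
    ∑ z ∈ box 3 (2 * n), criticalTwoPoint 3 z ≤ 217 * ∑ z ∈ box 3 n, criticalTwoPoint 3 z := by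
  obtain ⟨m, hm⟩ : ∃ m : ℕ, m = (n + 1) / 3 := ⟨_, rfl⟩
  have h3m : 3 * m ≤ n + 1 := by omega
  have hmn : m ≤ n := by omega
  have hA := criticalBoxSum_le_add_card_mul_axis (n := n) (N := 2 * n) (by omega)
  have hB := card_mul_axis_le_criticalBoxSum (s := n + 1) (n := n) h3m hmn
  have hcard : (((2 * (2 * n) + 1) ^ 3 : ℕ) : ℝ) ≤ 216 * (((2 * m + 1) ^ 3 : ℕ) : ℝ) := by
    have h1 : ((2 * (2 * n) + 1 : ℕ) : ℝ) ≤ 6 * ((2 * m + 1 : ℕ) : ℝ) := by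
      have : 2 * (2 * n) + 1 ≤ 6 * (2 * m + 1) := by omega
      exact_mod_cast this
    have h2 := pow_le_pow_left₀ (by positivity) h1 3
    push_cast at h2 ⊢
    nlinarith [h2]
  have hG : 0 ≤ criticalTwoPoint 3 (Pi.single 0 ((n + 1 : ℕ) : ℤ)) := criticalTwoPoint_nonneg' _
  have hkey : (((2 * (2 * n) + 1) ^ 3 : ℕ) : ℝ) * criticalTwoPoint 3 (Pi.single 0 ((n + 1 : ℕ) : ℤ))
      ≤ 216 * ∑ z ∈ box 3 n, criticalTwoPoint 3 z := by
    calc (((2 * (2 * n) + 1) ^ 3 : ℕ) : ℝ) * criticalTwoPoint 3 (Pi.single 0 ((n + 1 : ℕ) : ℤ))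
        ≤ 216 * (((2 * m + 1) ^ 3 : ℕ) : ℝ) * criticalTwoPoint 3 (Pi.single 0 ((n + 1 : ℕ) : ℤ)) :=
          mul_le_mul_of_nonneg_right hcard hG
      _ = 216 * ((((2 * m + 1) ^ 3 : ℕ) : ℝ) * criticalTwoPoint 3 (Pi.single 0 ((n + 1 : ℕ) : ℤ))) :=
          by ring
      _ ≤ 216 * ∑ z ∈ box 3 n, criticalTwoPoint 3 z := by linarith [hB]
  linarith [hA, hkey]

/-- Iterated doubling: `χ_{2^k n}(β_c) ≤ 217^k χ_n(β_c)`. -/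
theorem criticalBoxSum_two_pow_mul_le (k n : ℕ) :
    ∑ z ∈ box 3 (2 ^ k * n), criticalTwoPoint 3 z ≤ 217 ^ k * ∑ z ∈ box 3 n, criticalTwoPoint 3 z := by
  induction k with
  | zero => simp
  | succ k ih =>
      calc ∑ z ∈ box 3 (2 ^ (k + 1) * n), criticalTwoPoint 3 z
          = ∑ z ∈ box 3 (2 * (2 ^ k * n)), criticalTwoPoint 3 z := by rw [pow_succ]; ring_nf
        _ ≤ 217 * ∑ z ∈ box 3 (2 ^ k * n), criticalTwoPoint 3 z := criticalBoxSum_two_mul_le _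
        _ ≤ 217 * (217 ^ k * ∑ z ∈ box 3 n, criticalTwoPoint 3 z) :=
            mul_le_mul_of_nonneg_left ih (by norm_num)
        _ = 217 ^ (k + 1) * ∑ z ∈ box 3 n, criticalTwoPoint 3 z := by rw [pow_succ]; ring

/-! ### The correlation length tends to infinity uniformly on `[β₀, β_c)` -/

/-- For every `M` and `β₁ < β_c` there is `β₀ ∈ [β₁, β_c)`, `β₀ > 0`, with `M ≤ ξ(β)` for all
`β ∈ [β₀, β_c)` (S1u `stub_corrLengthUnbounded` and the monotonicity of `ξ` on `(0, β_c)`). -/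
theorem eventually_le_isingCorrLength (M β₁ : ℝ) (hβ₁ : β₁ < criticalBeta 3) :
    ∃ β₀ : ℝ, β₁ ≤ β₀ ∧ 0 < β₀ ∧ β₀ < criticalBeta 3 ∧
      ∀ β : ℝ, β₀ ≤ β → β < criticalBeta 3 → M ≤ isingCorrLength 3 β := by
  have hβc : 0 < criticalBeta 3 := criticalBeta_pos_holds (d := 3) (by norm_num)
  obtain ⟨β₀, hβ₀ge, hβ₀lt, hM⟩ :=
    stub_corrLengthUnbounded (max β₁ (criticalBeta 3 / 2)) M (max_lt hβ₁ (by linarith))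
  have hβ₀pos : 0 < β₀ := lt_of_lt_of_le (by linarith) ((le_max_right _ _).trans hβ₀ge)
  exact ⟨β₀, (le_max_left _ _).trans hβ₀ge, hβ₀pos, hβ₀lt,
    fun β hβ hβc' => hM.trans (isingCorrLength_mono hβ₀pos hβ hβc')⟩

/-! ### One window constant suffices -/

/-- **Comparability at one window constant `r > 0` implies the stub (all `R`).** Given `R`, take
`2^k ≥ 2R/r` and `β₀ ≥ β₂` with `r ξ(β) ≥ 2` on `[β₀, β_c)`; for `n ≤ R ξ(β)` and
`n₀ = ⌊r ξ(β)⌋ ≥ r ξ(β)/2`, `n ≤ 2^k n₀`, so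
`χ_n(β_c) ≤ χ_{2^k n₀}(β_c) ≤ 217^k χ_{n₀}(β_c) ≤ 217^k A χ(β)`. -/
theorem susceptibilityComparability_of_oneScale {r A β₂ : ℝ} (hr : 0 < r) (hA : 0 < A)
    (hβ₂ : β₂ < criticalBeta 3)
    (H : ∀ β : ℝ, β₂ ≤ β → β < criticalBeta 3 → ∀ n : ℕ,
        (n : ℝ) ≤ r * isingCorrLength 3 β →
        ∑ z ∈ box 3 n, twoPointPlus 3 (criticalBeta 3) z ≤ A * (susceptibility 3 β).toReal) :
    ∀ R : ℝ, 0 < R → ∃ A' β₂' : ℝ, 0 < A' ∧ β₂' < criticalBeta 3 ∧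
      ∀ β : ℝ, β₂' ≤ β → β < criticalBeta 3 → ∀ n : ℕ,
        (n : ℝ) ≤ R * isingCorrLength 3 β →
        ∑ z ∈ box 3 n, twoPointPlus 3 (criticalBeta 3) z ≤ A' * (susceptibility 3 β).toReal := by
  intro R hR
  obtain ⟨k, hk⟩ : ∃ k : ℕ, 2 * R / r ≤ 2 ^ k := by
    obtain ⟨k, hk⟩ := pow_unbounded_of_one_lt (2 * R / r) (by norm_num : (1 : ℝ) < 2)
    exact ⟨k, hk.le⟩
  obtain ⟨β₀, hβ₂β₀, hβ₀pos, hβ₀c, hξ⟩ := eventually_le_isingCorrLength (2 / r) β₂ hβ₂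
  refine ⟨217 ^ k * A, β₀, by positivity, hβ₀c, fun β hβ₀β hββc n hn => ?_⟩
  have hβ₂β : β₂ ≤ β := hβ₂β₀.trans hβ₀β
  obtain ⟨ξ, hξdef⟩ : ∃ ξ : ℝ, ξ = isingCorrLength 3 β := ⟨_, rfl⟩
  have hξge : 2 / r ≤ ξ := hξdef ▸ hξ β hβ₀β hββc
  have hrξ : 2 ≤ r * ξ := by
    rw [div_le_iff₀ hr] at hξge
    linarith
  have hrξ0 : 0 ≤ r * ξ := by linarith
  obtain ⟨n₀, hn₀def⟩ : ∃ n₀ : ℕ, n₀ = ⌊r * ξ⌋₊ := ⟨_, rfl⟩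
  have hn₀le : (n₀ : ℝ) ≤ r * ξ := hn₀def ▸ Nat.floor_le hrξ0
  have hn₀ge : r * ξ / 2 ≤ n₀ := by
    have h := Nat.lt_floor_add_one (r * ξ)
    rw [← hn₀def] at h
    linarith
  have Hβ := H β hβ₂β hββc
  rw [← hξdef] at Hβ hn
  have hcomp := Hβ n₀ hn₀le
  have hn' : n ≤ 2 ^ k * n₀ := by
    have h2k : (0 : ℝ) ≤ 2 ^ k := by positivity
    have h1 : (n : ℝ) ≤ 2 ^ k * (n₀ : ℝ) := by
      calc (n : ℝ) ≤ R * ξ := hn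
        _ = (2 * R / r) * (r * ξ / 2) := by field_simp
        _ ≤ 2 ^ k * (r * ξ / 2) := mul_le_mul_of_nonneg_right hk (by linarith)
        _ ≤ 2 ^ k * n₀ := mul_le_mul_of_nonneg_left hn₀ge h2k
    exact_mod_cast h1
  calc ∑ z ∈ box 3 n, twoPointPlus 3 (criticalBeta 3) z
      = ∑ z ∈ box 3 n, criticalTwoPoint 3 z := rfl
    _ ≤ ∑ z ∈ box 3 (2 ^ k * n₀), criticalTwoPoint 3 z := boxSum_mono hn'
    _ ≤ 217 ^ k * ∑ z ∈ box 3 n₀, criticalTwoPoint 3 z := criticalBoxSum_two_pow_mul_le k n₀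
    _ = 217 ^ k * ∑ z ∈ box 3 n₀, twoPointPlus 3 (criticalBeta 3) z := rfl
    _ ≤ 217 ^ k * (A * (susceptibility 3 β).toReal) :=
        mul_le_mul_of_nonneg_left hcomp (by positivity)
    _ = 217 ^ k * A * (susceptibility 3 β).toReal := by ring

/-- **The stub is equivalent to its single-scale form.** -/
theorem susceptibilityComparability_iff_oneScale :
    (∀ R : ℝ, 0 < R → ∃ A β₂ : ℝ, 0 < A ∧ β₂ < criticalBeta 3 ∧
      ∀ β : ℝ, β₂ ≤ β → β < criticalBeta 3 → ∀ n : ℕ,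
        (n : ℝ) ≤ R * isingCorrLength 3 β →
        ∑ z ∈ box 3 n, twoPointPlus 3 (criticalBeta 3) z ≤ A * (susceptibility 3 β).toReal) ↔
    (∃ r A β₂ : ℝ, 0 < r ∧ 0 < A ∧ β₂ < criticalBeta 3 ∧
      ∀ β : ℝ, β₂ ≤ β → β < criticalBeta 3 → ∀ n : ℕ,
        (n : ℝ) ≤ r * isingCorrLength 3 β →
        ∑ z ∈ box 3 n, twoPointPlus 3 (criticalBeta 3) z ≤ A * (susceptibility 3 β).toReal) := by
  constructor
  · intro h
    obtain ⟨A, β₂, hA, hβ₂, H⟩ := h 1 one_pos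
    exact ⟨1, A, β₂, one_pos, hA, hβ₂, H⟩
  · rintro ⟨r, A, β₂, hr, hA, hβ₂, H⟩
    exact susceptibilityComparability_of_oneScale hr hA hβ₂ H

/-! ### The registered stub S2d -/

/-- **S2d — SusceptibilityComparability from one scale** (registered stub of skeleton v5, line
`registered`, crux `NearCriticalLeeYangGap`, item stmt-CriticalPhenomena-4945; Messager–Miracle-Solé
doubling `χ_{2n}(β_c) ≤ 217·χ_n(β_c)` and `ξ(β) → ∞` as `β ↑ β_c`): the averaged near-critical
comparability `χ_n(β_c) ≤ A χ(β)` for `n ≤ r ξ(β)`, `β ∈ [β₂, β_c)`, at ONE window constant `r > 0`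
gives it at every window constant `R > 0` (`susceptibilityComparability_of_oneScale`, with
`A' = 217^k A`, `2^k ≥ 2R/r`). The antecedent is the open single-scale stub S2χ₁
`stub_susceptibilityComparabilityOneScale`, which is not asserted here. -/
theorem stub_susceptibilityComparability_of_oneScale :
    (∃ r A β₂ : ℝ, 0 < r ∧ 0 < A ∧ β₂ < Literature.Probability.LatticeModels.criticalBeta 3 ∧
      ∀ β : ℝ, β₂ ≤ β → β < Literature.Probability.LatticeModels.criticalBeta 3 → ∀ n : ℕ,
        (n : ℝ) ≤ r * Literature.Probability.LatticeModels.isingCorrLength 3 β →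
        ∑ z ∈ Literature.Probability.LatticeModels.box 3 n,
            Literature.Probability.LatticeModels.twoPointPlus 3
              (Literature.Probability.LatticeModels.criticalBeta 3) z ≤
          A * (Literature.Probability.LatticeModels.susceptibility 3 β).toReal) →
    ∀ R : ℝ, 0 < R → ∃ A β₂ : ℝ, 0 < A ∧ β₂ < Literature.Probability.LatticeModels.criticalBeta 3 ∧
      ∀ β : ℝ, β₂ ≤ β → β < Literature.Probability.LatticeModels.criticalBeta 3 → ∀ n : ℕ,
        (n : ℝ) ≤ R * Literature.Probability.LatticeModels.isingCorrLength 3 β →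
        ∑ z ∈ Literature.Probability.LatticeModels.box 3 n,
            Literature.Probability.LatticeModels.twoPointPlus 3
              (Literature.Probability.LatticeModels.criticalBeta 3) z ≤
          A * (Literature.Probability.LatticeModels.susceptibility 3 β).toReal := by
  rintro ⟨r, A, β₂, hr, hA, hβ₂, H⟩
  exact susceptibilityComparability_of_oneScale hr hA hβ₂ H

end Summit.CriticalPhenomena.Ising3DConformalLimit.LeeYangGapNearCriticalLeeYangGap

end
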